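import Summits.ResolutionOfSingularities.KangarooAtlas.MizutaniProjectiveMultiplicity
import Summits.ResolutionOfSingularities.KangarooAtlas.MizutaniAttainedMultiplicity
import Literature.AlgebraicGeometry.Resolution.HironakaGroupSchemeAdditiveGenerators
import Literature.AlgebraicGeometry.Resolution.RidgeGiraudBasis
import HarnessLib

/-!
# Mizutani's conjecture — the multiplicity `mult_𝔭(Proj(S/fS))` as a NUMBER, and `U(𝔭)`, `U_+(𝔭)S` by that number

Cell topic `Summits/ResolutionOfSingularities/KangarooAtlas` (pub-rosobs); namespace
`Summit.ResolutionOfSingularities.KangarooAtlas.Mizutani`.  Companion to the Lean transcription of the in-house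
note MIZUTANI-PROOF-g59 (AI-written, AI-audited; *AI review is weaker than expert review*; not a resolution
theorem; NOT summit progress).

Mizutani (Nagoya Math. J. 52 (1973) p. 85 L21–29, Def. 1.1) writes

  «`U(p) = Σ_{m ≥ 0} U_m(p)`, `U_m(p) = {f | f ∈ S_m, mult_p(Proj(S/fS)) ≥ m}`, … `B_{P,p} = Spec(S/U_+(p)S)`,
   `U_+(p) = Σ_{m>0} U_m(p)`»

with `mult_p` the multiplicity at the point `p ∈ ℙⁿ` of the hypersurface `Proj(S/fS)` — a NUMBER attached to `f`
and `p`.  The res-hironaka typing file renders «`mult_p f ≥ m`» as the predicate `f ∈ symbPow k 𝔭 m`, and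
`MizutaniProjectiveMultiplicity.lean` proved that predicate equivalent to `m ≤ e(𝒪_{ℙⁿ,𝔭}/(f/X_i^d))` (Samuel
multiplicity of the local ring of the hypersurface at the point, Matsumura §14) for a nonzero form `f ∈ 𝔭` of degree
`d` and a chart `X_i ∉ 𝔭`.  This file packages that multiplicity as ONE number

* `projMult 𝔭 hP d f : ℕ` — `e(𝒪_{ℙⁿ,𝔭}/(f/X_i^d))` if the form `f` of degree `d` lies in `𝔭` (the hypersurface
  passes through the point; any chart, `projMult_eq_samuelMultiplicity`), and `0` otherwise —

and states Mizutani's three displayed formulas with it, symbol for symbol, for every point `𝔭` of every `ℙⁿ_k`: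

* `mem_symbPow_iff_le_projMult` — for a NONZERO form `f` of degree `d` and every `m`:
  `f ∈ symbPow k 𝔭 m ↔ m ≤ projMult 𝔭 hP d f` (on or off the hypersurface);
* **`mem_multAlgebra_iff_le_projMult`** — for `f ∈ S_m`: `f ∈ U(𝔭)` (tree `multAlgebra k 𝔭`)
  `↔ f = 0 ∨ m ≤ projMult 𝔭 hP m f` — «`U(p) ∩ S_m = U_m(p) = {f ∈ S_m | mult_p(Proj(S/fS)) ≥ m}`»
  (the zero form belongs to every `U_m(p)`, a vector space);
* **`bIdeal_eq_span_projMult`** — `U_+(𝔭)S` (tree `bIdeal k 𝔭`, the ideal of `B_{P,𝔭} = Spec(S/U_+(𝔭)S)`) is the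
  ideal generated by the nonzero forms `f` of positive degree `m` with `m ≤ mult_𝔭(Proj(S/fS))`;
* `mem_hirForms_iff_le_projMult`, `mem_invForms_iff_le_projMult` — the additive pieces: `a ∈ U(𝔭) ∩ L_e`
  (Mizutani §1 (c)), resp. `a ∈ (L_B)_e` (Oda's DEFINITION of the vocabulary file, via Oda's equality
  `hirForms_eq_invForms`), iff `Σ a_j X_j^{p^e} = 0` or its hypersurface has multiplicity `≥ p^e` at `𝔭`;
* `projMult_attP_addForm_attA0` — example: Mizutani's extremal hypersurface `Σ_j u_1^{q−1−j}(u_0 x_{0j}^q − x_{1j}^q)`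
  has multiplicity exactly `q = p^e` at its point `attP`.

On the way: `le_degree_of_mem_symbPow` — a nonzero form of degree `d` lies in `𝔭^{(m)}` only for `m ≤ d`
(the top Hasse–Schmidt derivatives of a form are its coefficients, and `D^{(β)} 𝔭^{(m)} ⊆ 𝔭^{(m−|β|)}`,
res-hironaka's `hasseDeriv_mem_symbPow`), whence **`projMult_le_degree`**: the multiplicity of a hypersurface of
degree `d` at any point of `ℙⁿ` (closed or not) is at most `d`; `projMult_pos_iff` (positive iff the point lies on
the hypersurface); `projMult_eq_adicOrder` («mult = ν», Hironaka's order `ν_{x'}(φ/X_0^d)`, Kyoto 1970 p. 154);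
and the chart-free description `bIdeal_eq_span_symbPow` of `U_+(𝔭)S` by the positive-degree homogeneous generators
(any prime `𝔭 ⊂ k[X_σ]`).

References: [Mizutani1973HironakaGroupSchemes] p. 85 L21–29, Def. 1.1; [Hironaka1970NumericalCharacters] p. 154
L24–29; [Matsumura1987] §14; [Dietel2015] Lemma (9.1.4) p. 108 (Hasse–Schmidt derivatives and `U_x`).
-/

noncomputable section

open MvPolynomial IsLocalRing Literature.RingTheory.HilbertSamuel Literature.AlgebraicGeometry.Resolution
  Literature.AlgebraicGeometry.Resolution.HironakaScheme

attribute [local instance] MvPolynomial.gradedAlgebra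

namespace Summit.ResolutionOfSingularities.KangarooAtlas.Mizutani

universe u v

/-! ### The degree bound `𝔭^{(m)} ∩ S_d ∖ 0 = ∅` for `m > d` -/

section DegreeBound

variable {k : Type u} [Field k] {σ : Type v} {𝔭 : Ideal (MvPolynomial σ k)} [h𝔭 : 𝔭.IsPrime]

/-- A nonzero constant has multiplicity `0` at every prime: `C c ∈ 𝔭^{(m)} ↔ m = 0` (`c ≠ 0`). [folklore] -/
theorem C_mem_symbPow_iff {c : k} (hc : c ≠ 0) (m : ℕ) : C c ∈ symbPow k 𝔭 m ↔ m = 0 := by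
  constructor
  · intro h
    by_contra hm
    have hC : (C c : MvPolynomial σ k) ∈ 𝔭 := mem_of_mem_symbPow (Nat.one_le_iff_ne_zero.mpr hm) h
    exact h𝔭.ne_top (𝔭.eq_top_of_isUnit_mem hC ((isUnit_iff_ne_zero.mpr hc).map C))
  · rintro rfl
    exact mem_symbPow_zero h𝔭.ne_top _

end DegreeBound

section DegreeBoundFin

variable {k : Type u} [Field k] {n : ℕ} {𝔭 : Ideal (MvPolynomial (Fin (n + 1)) k)} [h𝔭 : 𝔭.IsPrime]

/-- **A nonzero form of degree `d` has multiplicity `≤ d` at every prime**: `φ ∈ S_d ∖ 0`, `φ ∈ 𝔭^{(m)} ⇒ m ≤ d`.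
Proof: for an exponent `β` of `φ` (`|β| = d`) the Hasse–Schmidt derivative `D^{(β)} φ` is the nonzero constant
`coeff_β φ` (`hasseDeriv_eq_C_coeff_of_degree_eq`) and lies in `𝔭^{(m − d)}` (`hasseDeriv_mem_symbPow`), so `m − d = 0`.
[cite: Dietel2015, Lemma (9.1.4) p. 108 (D_M U_d ⊆ U_{d−|M|})] -/
theorem le_degree_of_mem_symbPow {d : ℕ} {φ : MvPolynomial (Fin (n + 1)) k}
    (hφ : φ ∈ homogeneousSubmodule (Fin (n + 1)) k d) (hφ0 : φ ≠ 0) {m : ℕ} (hm : φ ∈ symbPow k 𝔭 m) :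
    m ≤ d := by
  obtain ⟨β, hβ⟩ := MvPolynomial.ne_zero_iff.mp hφ0
  have hφd : φ.IsHomogeneous d := (mem_homogeneousSubmodule d φ).mp hφ
  have hβd : β.degree = d := by
    rw [Finsupp.degree_eq_weight_one]
    exact hφd hβ
  have h1 : hasseDeriv k β φ ∈ symbPow k 𝔭 (m - β.degree) := hasseDeriv_mem_symbPow hm β
  rw [hasseDeriv_eq_C_coeff_of_degree_eq hφd hβd, C_mem_symbPow_iff hβ, hβd] at h1
  omega

/-- Equivalently: for `m > d` the only form of degree `d` in `𝔭^{(m)}` is `0` (`U_m(𝔭) ∩ S_d = 0`). [folklore] -/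
theorem eq_zero_of_mem_symbPow_of_lt {d : ℕ} {φ : MvPolynomial (Fin (n + 1)) k}
    (hφ : φ ∈ homogeneousSubmodule (Fin (n + 1)) k d) {m : ℕ} (hdm : d < m) (hm : φ ∈ symbPow k 𝔭 m) :
    φ = 0 := by
  by_contra hφ0
  exact absurd (le_degree_of_mem_symbPow hφ hφ0 hm) (not_le.mpr hdm)

end DegreeBoundFin

/-! ### `U_+(𝔭)S` by its positive-degree homogeneous generators (any prime) -/

section BIdealSpan

variable {k : Type u} [Field k] {σ : Type v} (𝔭 : Ideal (MvPolynomial σ k)) [h𝔭 : 𝔭.IsPrime]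

/-- **`U_+(𝔭)S = (U_m(𝔭) : m ≥ 1)`**: the ideal `bIdeal k 𝔭` of `B_{P,𝔭}` (generated by the elements of `U(𝔭)` with
zero constant term) is generated by the homogeneous `φ` of POSITIVE degree `m` with `φ ∈ 𝔭^{(m)}` — Mizutani's
«`U_+(p) = Σ_{m>0} U_m(p)`» (each element of `U(𝔭)` is the sum of its homogeneous components, which lie in the
`U_m(𝔭)`, `homogeneousComponent_mem_symbPow_of_mem_multAlgebra`; the degree-`0` component is the constant term).
[cite: Mizutani1973HironakaGroupSchemes, Def. 1.1 and p. 85 L21–29 (U_+(p) = Σ_{m>0} U_m(p))] -/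
theorem bIdeal_eq_span_symbPow :
    bIdeal k 𝔭 = Ideal.span {φ | ∃ m : ℕ, 1 ≤ m ∧ φ.IsHomogeneous m ∧ φ ∈ symbPow k 𝔭 m} := by
  classical
  apply le_antisymm
  · -- `⊆`: an element of `U(𝔭)` without constant term is the sum of its components of positive degree
    refine Ideal.span_le.mpr ?_
    rintro u ⟨hu, hu0⟩
    have hu0' : coeff 0 u = 0 := by
      have : constantCoeff u = 0 := hu0
      rwa [constantCoeff_eq] at this
    rw [← sum_homogeneousComponent u]
    refine Ideal.sum_mem _ fun i hi => ?_
    rcases Nat.eq_zero_or_pos i with rfl | hi1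
    · rw [homogeneousComponent_zero, hu0', map_zero]
      exact Ideal.zero_mem _
    · exact Ideal.subset_span ⟨i, hi1, homogeneousComponent_isHomogeneous i u,
        homogeneousComponent_mem_symbPow_of_mem_multAlgebra hu i⟩
  · -- `⊇`: such a `φ` lies in `U(𝔭)` and has no constant term
    refine Ideal.span_le.mpr ?_
    rintro φ ⟨m, hm1, hφm, hφs⟩
    refine Ideal.subset_span ⟨Algebra.subset_adjoin ⟨m, hφm, hφs⟩, ?_⟩
    show constantCoeff φ = 0
    rw [constantCoeff_eq]
    exact hφm.coeff_eq_zero (by rw [map_zero]; omega)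

end BIdealSpan

/-! ### The number `mult_𝔭(Proj(S/φS))` -/

section PointMultiplicity

variable {k : Type u} [Field k] {n : ℕ}
  (𝔭 : Ideal (MvPolynomial (Fin (n + 1)) k)) [h𝔭 : 𝔭.IsPrime]

omit h𝔭 in
/-- A chart at the point: an index `i` with `X_i ∉ 𝔭` (choice; `exists_X_not_mem_of_isPoint`). [folklore] -/
def pointChart (hP : IsPoint k 𝔭) : Fin (n + 1) := (exists_X_not_mem_of_isPoint 𝔭 hP).choose

omit h𝔭 in
/-- The chosen chart variable misses the point. [folklore] -/
theorem X_pointChart_not_mem (hP : IsPoint k 𝔭) : (X (pointChart 𝔭 hP) : MvPolynomial (Fin (n + 1)) k) ∉ 𝔭 :=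
  (exists_X_not_mem_of_isPoint 𝔭 hP).choose_spec

open scoped Classical in
/-- **`mult_𝔭(Proj(S/φS))`** (Mizutani p. 85 L23–25), for a point `𝔭` of `ℙⁿ_k` and a form `φ` of degree `d`: the
Samuel multiplicity `e(𝒪_{ℙⁿ,𝔭}/(φ/X_i^d))` (Matsumura §14; tree `samuelMultiplicity`) of the local ring at `𝔭` of
the hypersurface `φ = 0` when `φ ∈ 𝔭` (computed in the chosen chart `X_i`, `i = pointChart 𝔭 hP`; independent of the
chart, `projMult_eq_samuelMultiplicity`), and `0` when `φ ∉ 𝔭` (the point is not on the hypersurface) or when `φ`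
is not a form of degree `d` (junk value). [cite: Mizutani1973HironakaGroupSchemes, p. 85 L23–25 (mult_p(Proj(S/fS))); Matsumura1987, §14] -/
def projMult (hP : IsPoint k 𝔭) (d : ℕ) (φ : MvPolynomial (Fin (n + 1)) k) : ℕ :=
  if h : φ ∈ homogeneousSubmodule (Fin (n + 1)) k d ∧ φ ∈ 𝔭 then
    @samuelMultiplicity
      (HomogeneousLocalization.AtPrime (homogeneousSubmodule (Fin (n + 1)) k) 𝔭 ⧸
        Ideal.span {projGerm 𝔭 (X (pointChart 𝔭 hP)) (Literature.AlgebraicGeometry.Motives.ProjectiveSpace.X_mem _)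
          (X_pointChart_not_mem 𝔭 hP) d φ h.1})
      _ (isLocalRing_projLocalRing_quotient 𝔭 hP (X_pointChart_not_mem 𝔭 hP) h.1 h.2)
  else 0

variable {𝔭}

/-- Off the hypersurface the multiplicity is `0`. [cite: Mizutani1973HironakaGroupSchemes, p. 85 L21–25 (U_0(p) = S_0)] -/
theorem projMult_of_not_mem (hP : IsPoint k 𝔭) (d : ℕ) {φ : MvPolynomial (Fin (n + 1)) k} (hφ𝔭 : φ ∉ 𝔭) :
    projMult 𝔭 hP d φ = 0 := by
  classical
  unfold projMult
  rw [dif_neg (fun h => hφ𝔭 h.2)]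

/-- **Chart independence**: for ANY variable `X_i ∉ 𝔭` and a form `φ ∈ 𝔭` of degree `d`,
`projMult 𝔭 hP d φ = e(𝒪_{ℙⁿ,𝔭}/(φ/X_i^d))` (`samuelMultiplicity_quotient_projGerm_X_eq`).
[cite: Mizutani1973HironakaGroupSchemes, p. 85 L23–25 (mult_p(Proj(S/fS)) is intrinsic); Matsumura1987, §14] -/
theorem projMult_eq_samuelMultiplicity (hP : IsPoint k 𝔭) {i : Fin (n + 1)}
    (hi : (X i : MvPolynomial (Fin (n + 1)) k) ∉ 𝔭) {d : ℕ} {φ : MvPolynomial (Fin (n + 1)) k}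
    (hφ : φ ∈ homogeneousSubmodule (Fin (n + 1)) k d) (hφ𝔭 : φ ∈ 𝔭)
    [IsLocalRing (HomogeneousLocalization.AtPrime (homogeneousSubmodule (Fin (n + 1)) k) 𝔭 ⧸
      Ideal.span {projGerm 𝔭 (X i) (Literature.AlgebraicGeometry.Motives.ProjectiveSpace.X_mem i) hi d φ hφ})] :
    projMult 𝔭 hP d φ =
      samuelMultiplicity (HomogeneousLocalization.AtPrime (homogeneousSubmodule (Fin (n + 1)) k) 𝔭 ⧸
        Ideal.span {projGerm 𝔭 (X i) (Literature.AlgebraicGeometry.Motives.ProjectiveSpace.X_mem i) hi d φ hφ}) := by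
  classical
  unfold projMult
  rw [dif_pos ⟨hφ, hφ𝔭⟩]
  haveI := isLocalRing_projLocalRing_quotient 𝔭 hP (X_pointChart_not_mem 𝔭 hP) hφ hφ𝔭
  exact samuelMultiplicity_quotient_projGerm_X_eq 𝔭 hP (X_pointChart_not_mem 𝔭 hP) hi φ hφ

/-- **`mult_𝔭 φ ≥ m ⟺ φ ∈ 𝔭^{(m)}` with the number**: for a point `𝔭` of `ℙⁿ_k`, a NONZERO form `φ` of degree `d`
and every `m`, `φ ∈ symbPow k 𝔭 m ↔ m ≤ projMult 𝔭 hP d φ` — on the hypersurface by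
`mem_symbPow_iff_le_samuelMultiplicity`, off it both sides say `m = 0`.
[cite: Mizutani1973HironakaGroupSchemes, p. 85 L23–25 (U_m(p) = {f ∈ S_m : mult_p(Proj(S/fS)) ≥ m}); Matsumura1987, §14] -/
theorem mem_symbPow_iff_le_projMult (hP : IsPoint k 𝔭) {d : ℕ} {φ : MvPolynomial (Fin (n + 1)) k}
    (hφ : φ ∈ homogeneousSubmodule (Fin (n + 1)) k d) (hφ0 : φ ≠ 0) (m : ℕ) :
    φ ∈ symbPow k 𝔭 m ↔ m ≤ projMult 𝔭 hP d φ := by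
  by_cases hφ𝔭 : φ ∈ 𝔭
  · haveI := isLocalRing_projLocalRing_quotient 𝔭 hP (X_pointChart_not_mem 𝔭 hP) hφ hφ𝔭
    rw [projMult_eq_samuelMultiplicity hP (X_pointChart_not_mem 𝔭 hP) hφ hφ𝔭]
    exact mem_symbPow_iff_le_samuelMultiplicity 𝔭 hP (X_pointChart_not_mem 𝔭 hP) φ hφ hφ𝔭 hφ0 m
  · rw [projMult_of_not_mem hP d hφ𝔭, mem_symbPow_iff_eq_zero_of_not_mem 𝔭 hφ𝔭, Nat.le_zero]

/-- **`mult = ν`**: on the hypersurface, `projMult 𝔭 hP d φ = ν(φ/X_i^d)`, Hironaka's order of the germ in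
`𝒪_{ℙⁿ,𝔭}` (any chart `X_i ∉ 𝔭`; nonzero form `φ ∈ 𝔭`).
[cite: Hironaka1970NumericalCharacters, p. 154 L24–29 (ν_{x'}(φ/X_0^d)); Mizutani1973HironakaGroupSchemes, p. 85 L23–25; Matsumura1987, §14] -/
theorem projMult_eq_adicOrder (hP : IsPoint k 𝔭) {i : Fin (n + 1)}
    (hi : (X i : MvPolynomial (Fin (n + 1)) k) ∉ 𝔭) {d : ℕ} {φ : MvPolynomial (Fin (n + 1)) k}
    (hφ : φ ∈ homogeneousSubmodule (Fin (n + 1)) k d) (hφ𝔭 : φ ∈ 𝔭) (hφ0 : φ ≠ 0) :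
    (projMult 𝔭 hP d φ : ℕ∞) =
      adicOrder (projGerm 𝔭 (X i) (Literature.AlgebraicGeometry.Motives.ProjectiveSpace.X_mem i) hi d φ hφ) := by
  haveI := isLocalRing_projLocalRing_quotient 𝔭 hP hi hφ hφ𝔭
  rw [projMult_eq_samuelMultiplicity hP hi hφ hφ𝔭]
  exact samuelMultiplicity_quotient_projGerm_eq_adicOrder 𝔭 hP hi φ hφ hφ𝔭 hφ0

/-- **The point lies on the hypersurface iff the multiplicity is positive** (nonzero form `φ` of degree `d`).
[cite: Mizutani1973HironakaGroupSchemes, p. 85 L23–25; Matsumura1987, §14 (Formula 14.2: e > 0)] -/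
theorem projMult_pos_iff (hP : IsPoint k 𝔭) {d : ℕ} {φ : MvPolynomial (Fin (n + 1)) k}
    (hφ : φ ∈ homogeneousSubmodule (Fin (n + 1)) k d) (hφ0 : φ ≠ 0) :
    0 < projMult 𝔭 hP d φ ↔ φ ∈ 𝔭 := by
  rw [Nat.lt_iff_add_one_le, zero_add, ← mem_symbPow_iff_le_projMult hP hφ hφ0 1, mem_symbPow_one_iff]

/-- **The multiplicity of a hypersurface of degree `d` at any point of `ℙⁿ` is at most `d`** (nonzero form; the
point need not be closed). [cite: Mizutani1973HironakaGroupSchemes, p. 85 L23–25; Dietel2015, Lemma (9.1.4) p. 108] -/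
theorem projMult_le_degree (hP : IsPoint k 𝔭) {d : ℕ} {φ : MvPolynomial (Fin (n + 1)) k}
    (hφ : φ ∈ homogeneousSubmodule (Fin (n + 1)) k d) (hφ0 : φ ≠ 0) :
    projMult 𝔭 hP d φ ≤ d :=
  le_degree_of_mem_symbPow hφ hφ0 ((mem_symbPow_iff_le_projMult hP hφ hφ0 _).mpr le_rfl)

/-! ### Mizutani's `U_m(p)`, `U(p)` and `U_+(p)S` with the number -/

/-- **`U_m(p) = {f ∈ S_m | mult_p(Proj(S/fS)) ≥ m}`** on the homogeneous generators: a form `φ ∈ S_m` belongs to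
the tree's `multGens k 𝔭` (the homogeneous elements of `U(𝔭)`) iff `φ = 0` or `m ≤ projMult 𝔭 hP m φ`.
[cite: Mizutani1973HironakaGroupSchemes, p. 85 L23–25] -/
theorem mem_multGens_iff_le_projMult (hP : IsPoint k 𝔭) {m : ℕ} {φ : MvPolynomial (Fin (n + 1)) k}
    (hφ : φ ∈ homogeneousSubmodule (Fin (n + 1)) k m) :
    φ ∈ multGens k 𝔭 ↔ φ = 0 ∨ m ≤ projMult 𝔭 hP m φ := by
  by_cases hφ0 : φ = 0
  · subst hφ0
    simp only [true_or, iff_true]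
    exact ⟨0, isHomogeneous_zero _ _ 0, mem_symbPow_zero h𝔭.ne_top _⟩
  · rw [← mem_symbPow_iff_le_projMult hP hφ hφ0 m]
    simp only [hφ0, false_or]
    constructor
    · rintro ⟨d, hφd, hφs⟩
      have hdm : d = m := hφd.inj_right ((mem_homogeneousSubmodule m φ).mp hφ) hφ0
      rwa [hdm] at hφs
    · exact fun h => ⟨m, (mem_homogeneousSubmodule m φ).mp hφ, h⟩

/-- **MIZUTANI p. 85 L21–25 AS ONE FORMULA: `U(p) = Σ_m U_m(p)`, `U_m(p) = {f ∈ S_m | mult_p(Proj(S/fS)) ≥ m}`.**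
For a point `𝔭` of `ℙⁿ_k` and `φ ∈ S_m`: `φ` lies in Hironaka's graded algebra `U(𝔭)` (tree `multAlgebra k 𝔭`, whose
degree-`m` piece is `U_m(𝔭)`, `homogeneousComponent_mem_symbPow_of_mem_multAlgebra`) iff `φ = 0` or
`m ≤ mult_𝔭(Proj(S/φS))` — the MULTIPLICITY being the Samuel multiplicity `projMult` of the local ring of the
hypersurface at the point. [cite: Mizutani1973HironakaGroupSchemes, p. 85 L21–25 (U(p), U_m(p)); Matsumura1987, §14] -/
theorem mem_multAlgebra_iff_le_projMult (hP : IsPoint k 𝔭) {m : ℕ} {φ : MvPolynomial (Fin (n + 1)) k}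
    (hφ : φ ∈ homogeneousSubmodule (Fin (n + 1)) k m) :
    φ ∈ multAlgebra k 𝔭 ↔ φ = 0 ∨ m ≤ projMult 𝔭 hP m φ := by
  rw [← mem_multGens_iff_le_projMult hP hφ]
  constructor
  · intro hu
    have hc := homogeneousComponent_mem_symbPow_of_mem_multAlgebra hu m
    rw [homogeneousComponent_of_mem hφ, if_pos rfl] at hc
    exact ⟨m, (mem_homogeneousSubmodule m φ).mp hφ, hc⟩
  · exact fun h => Algebra.subset_adjoin h

/-- **`B_{P,𝔭} = Spec(S/U_+(𝔭)S)` with the number (Mizutani Def. 1.1 verbatim)**: for a point `𝔭` of `ℙⁿ_k`, the ideal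
`U_+(𝔭)S` (tree `bIdeal k 𝔭`) is generated by the NONZERO forms `φ` of POSITIVE degree `m` whose hypersurface
`Proj(S/φS)` has multiplicity `≥ m` at `𝔭`, `m ≤ projMult 𝔭 hP m φ` (hence `= m`, `projMult_le_degree`).
[cite: Mizutani1973HironakaGroupSchemes, Def. 1.1 (B_{P,p} = Spec(S/U_+(p)S), U_+(p) = Σ_{m>0} U_m(p)) and p. 85 L23–25] -/
theorem bIdeal_eq_span_projMult (hP : IsPoint k 𝔭) :
    bIdeal k 𝔭 = Ideal.span {φ | ∃ m : ℕ, 1 ≤ m ∧ φ ∈ homogeneousSubmodule (Fin (n + 1)) k m ∧ φ ≠ 0 ∧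
      m ≤ projMult 𝔭 hP m φ} := by
  rw [bIdeal_eq_span_symbPow 𝔭]
  apply le_antisymm
  · refine Ideal.span_le.mpr ?_
    rintro φ ⟨m, hm1, hφm, hφs⟩
    have hφ : φ ∈ homogeneousSubmodule (Fin (n + 1)) k m := (mem_homogeneousSubmodule m φ).mpr hφm
    by_cases hφ0 : φ = 0
    · rw [hφ0]; exact Ideal.zero_mem _
    · exact Ideal.subset_span ⟨m, hm1, hφ, hφ0, (mem_symbPow_iff_le_projMult hP hφ hφ0 m).mp hφs⟩
  · refine Ideal.span_le.mpr ?_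
    rintro φ ⟨m, hm1, hφ, hφ0, hle⟩
    exact Ideal.subset_span ⟨m, hm1, (mem_homogeneousSubmodule m φ).mp hφ,
      (mem_symbPow_iff_le_projMult hP hφ hφ0 m).mpr hle⟩

/-- On the generators of `U_+(𝔭)S` the inequality is an equality: a nonzero form of positive degree `m` with
`m ≤ mult_𝔭` has `mult_𝔭 = m` (`projMult_le_degree`) — the generating forms are exactly those «of multiplicity equal
to their degree» at the point (cones with vertex containing `𝔭`). [cite: Mizutani1973HironakaGroupSchemes, p. 85 L23–25] -/
theorem projMult_eq_degree_of_le (hP : IsPoint k 𝔭) {m : ℕ} {φ : MvPolynomial (Fin (n + 1)) k}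
    (hφ : φ ∈ homogeneousSubmodule (Fin (n + 1)) k m) (hφ0 : φ ≠ 0) (hle : m ≤ projMult 𝔭 hP m φ) :
    projMult 𝔭 hP m φ = m :=
  le_antisymm (projMult_le_degree hP hφ hφ0) hle

/-! ### The additive pieces: `U(𝔭) ∩ L_e` and Oda's `(L_B)_e` by the number -/

/-- **Mizutani §1 (c) with the number**: a coefficient vector `a` lies in `U(𝔭) ∩ L_e` (tree `hirForms k p 𝔭 e`)
iff its additive form `h = Σ_j a_j X_j^{p^e}` is `0` or the hypersurface `Proj(S/hS)` has multiplicity `≥ p^e`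
(`= p^e = deg h`, `projMult_eq_degree_of_le`) at the point `𝔭`.
[cite: Mizutani1973HironakaGroupSchemes, §1 (c) p. 86 (U(p) ∩ L, L_e) and p. 85 L23–25] -/
theorem mem_hirForms_iff_le_projMult (p : ℕ) [Fact p.Prime] [CharP k p] (hP : IsPoint k 𝔭) (e : ℕ)
    (a : Fin (n + 1) → k) :
    a ∈ hirForms k p 𝔭 e ↔
      addForm k p e a = 0 ∨ p ^ e ≤ projMult 𝔭 hP (p ^ e) (addForm k p e a) := by
  rw [mem_hirForms_iff]
  change addForm k p e a ∈ symbPow k 𝔭 (p ^ e) ↔ _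
  by_cases h0 : addForm k p e a = 0
  · rw [h0]
    simp only [true_or, iff_true]
    exact mem_symbPow_of_mem_pow h𝔭.ne_top (Ideal.zero_mem _)
  · rw [mem_symbPow_iff_le_projMult hP (addForm_mem_homogeneousSubmodule p e a) h0]
    simp only [h0, false_or]

/-- **Oda's `(L_B)_e` by the number** (through Oda's equality `hirForms_eq_invForms`, Oda 1973 Prop. 2.2 (ii), a tree
theorem): `a ∈ invForms k p 𝔭 e` — the DEFINITION of the enclosure's vocabulary file, Oda 1983-II p. 1168 — iff the
additive form `Σ_j a_j X_j^{p^e}` is `0` or its hypersurface has multiplicity `≥ p^e` at `𝔭`, multiplicity = Samuel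
multiplicity of the local ring at the point.  This closes the circle «Oda's differential-operator description =
Hironaka's/Mizutani's multiplicity description» on the level of NUMBERS.
[cite: Oda1983HironakaGroupSchemeII, §2 (p. 1168: (L_B)_e); Mizutani1973HironakaGroupSchemes, §1 (c) and p. 85 L23–25; Matsumura1987, §14] -/
theorem mem_invForms_iff_le_projMult (p : ℕ) [Fact p.Prime] [CharP k p] (hP : IsPoint k 𝔭) (e : ℕ)
    (a : Fin (n + 1) → k) :
    a ∈ invForms k p 𝔭 e ↔
      addForm k p e a = 0 ∨ p ^ e ≤ projMult 𝔭 hP (p ^ e) (addForm k p e a) := by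
  rw [← hirForms_eq_invForms 𝔭 e]
  exact mem_hirForms_iff_le_projMult p hP e a

end PointMultiplicity

/-! ### Example: Mizutani's extremal hypersurface has multiplicity `p^e` (= its degree) at its point -/

section Example

variable {k : Type u} [Field k] {n : ℕ} (p : ℕ) [hp : Fact p.Prime]

omit hp in
/-- The coefficient of `X_j^{p^e}` in the additive form `Σ_i a_i X_i^{p^e}` is `a_j` (`p^e ≠ 0`). [folklore] -/
theorem coeff_addForm_single [CharP k p] {e : ℕ} (hq : p ^ e ≠ 0) (a : Fin (n + 1) → k) (j : Fin (n + 1)) :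
    coeff (Finsupp.single j (p ^ e)) (addForm k p e a) = a j := by
  classical
  unfold addForm
  rw [coeff_sum, Finset.sum_eq_single j]
  · rw [C_mul_X_pow_eq_monomial, coeff_monomial, if_pos rfl]
  · intro i _ hij
    rw [C_mul_X_pow_eq_monomial, coeff_monomial, if_neg]
    exact fun h => hij (Finsupp.single_left_injective hq h)
  · intro h
    exact absurd (Finset.mem_univ j) h

/-- A nonzero coefficient vector gives a nonzero additive form. [folklore] -/
theorem addForm_ne_zero [CharP k p] {e : ℕ} {a : Fin (n + 1) → k} (ha : a ≠ 0) : addForm k p e a ≠ 0 := by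
  obtain ⟨j, hj⟩ := Function.ne_iff.mp ha
  intro h
  have hc := coeff_addForm_single (k := k) p (e := e) (pow_ne_zero _ hp.out.ne_zero) a j
  rw [h, coeff_zero] at hc
  exact hj (by rw [← hc]; rfl)

/-- **Example (Mizutani's `H_e`-type point)**: at the point `attP` of `ℙ^{2p^e−1}` over `𝔽_p(u_0,u_1)` (more generally
`F(u_0,u_1)`, `MizutaniAttainedPoint.lean`), the hypersurface of the invariant additive form `a⁰`,
`Σ_j u_1^{q−1−j}(u_0 x_{0j}^q − x_{1j}^q) = 0` (`q = p^e`, `e ≥ 1`), has multiplicity EXACTLY `p^e` — its degree — at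
the point: `mult_𝔭(Proj(S/a⁰S)) = p^e` (from `attA0_mem_hirForms` and `projMult_le_degree`).
[cite: Mizutani1973HironakaGroupSchemes, Example 2.1 and Remark 2.10; Matsumura1987, §14] -/
theorem projMult_attP_addForm_attA0 {F : Type u} [Field F] [CharP F p] {e : ℕ} (he : 1 ≤ e) :
    projMult (h𝔭 := attP_isPrime) (attP F p e) isPoint_attP (p ^ e)
        (addForm (RatField F 2) p e (attA0 F p e)) = p ^ e := by
  haveI := (attP_isPrime (F := F) (p := p) (e := e))
  have h0 : addForm (RatField F 2) p e (attA0 F p e) ≠ 0 := addForm_ne_zero p attA0_ne_zero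
  have hmem := (mem_hirForms_iff_le_projMult p (isPoint_attP (F := F) (p := p) (e := e)) e (attA0 F p e)).mp
    (attA0_mem_hirForms he)
  exact projMult_eq_degree_of_le isPoint_attP (addForm_mem_homogeneousSubmodule p e _) h0 (hmem.resolve_left h0)

end Example

end Summit.ResolutionOfSingularities.KangarooAtlas.Mizutani

end
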